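import Summits.Ventures.HSemireg.WedgeCarrierEcl
import Summits.Ventures.HSemireg.ContractionSpanThetaSecantNondeg

/-!
# Venture HSemireg — ADAPTED WEIL FRAMES EXIST: the intrinsic form of the p4-carrier dictionary

HONEST FRAMING. Part of the Lean index of the computation cell `pub-hsemireg` (seat w3-mod4-1 gen 8, W3 SPECIAL FIBRES,
MOD4-OFFSPLIT §1 / §12 «the only non-Lean input of THEOREM R_f on the carrier is the adapted-Weil-frame identification»).
Finite-dimensional exterior / linear algebra over a field ONLY: no variety, no cohomology theory, no semiregularity map is
constructed here; nothing here says that HC / HC_CM / HC_AV holds; no Literature fact is declared or used.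

WHAT IS PROVED. The carrier theorems of `WedgeWeilCarrier*.lean` / `Mod4Carrier*.lean` take an ADAPTED BASIS
`bV : Basis (Fin (N + N)) K V` BY VALUE (`ℓ_a = bV a` spanning `L`, `m_a = bV (N + a)`, `Θ = Σ_a ℓ_a ∧ m_a`, the two Weil blocks
`⟨ℓ_c (c ≥ p), m_c (c < p)⟩` and `⟨ℓ_c (c < p), m_c (c ≥ p)⟩` carrying `w₊ = wUp bV p`, `w₋ = wLow bV p`). Here, in the idiom of
p6's `ContractionSpan.exists_basis_twoVector_eq`, such a frame is DERIVED from intrinsic data — an abstract **Weil datum**: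
a `K`-space `V` of dimension `2(p + r)`; a subspace `L` («`H^{0,1}`») of dimension `p + r`; two DISJOINT subspaces `P`, `Q`
(«the two `k`-eigenblocks `H¹_±` of the Weil field») with `dim (L ⊓ Q) = p`, `dim (L ⊓ P) = r` («signature `(p, r)`»); and a
2-vector `Θ` («the polarisation») lying in `span{x ∧ l : x ∈ P, l ∈ L ⊓ Q or x ∈ Q, l ∈ L ⊓ P}` (the WEIL GENERATING SET) («Hodge type `(1,1)` and
`k`-bidegree `(1,1)`: `E(ηu, v) = E(u, η̄v)`») and NON-DEGENERATE on `L^⊥` (`ι(L) ⊆ span{ι_φ Θ : φ ∈ L^⊥}`, the hypothesis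
`hnd` of p6 / of `ContractionSpan.span_secant_eq`). THEN (`exists_adapted_basis`) there is a basis `bV` of `V` indexed by
`Fin ((p + r) + (p + r))` with `Lsp bV = L`, `ℓ_a ∈ Q, m_a ∈ P` for `a < p`, `ℓ_a ∈ P, m_a ∈ Q` for `a ≥ p`, and
`Θ = Σ_a ι(ℓ_a) ι(m_a) = Σ_{k < p + r} LM bV k` — i.e. EVERY abstract Weil datum is the datum of an adapted Weil frame, so the
carrier theorems hold for it with `w₊`, `w₋` the top forms of `P`, `Q` (sequel). Conversely (`sum_ι_mul_ι_mem_span_weilGen`,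
`ι_mem_span_contractLeft_sum`) the blocks of ANY basis form such a datum, so the two hypotheses on `Θ` are exactly right.
Proof: collect `Θ` on bases of `L ⊓ Q` and `L ⊓ P`
(span induction carrying the block memberships), negate the partners, and get their independence from the dual system
`θ_b ∈ L^⊥`, `θ_b(m_a) = -δ_{ab}` supplied by non-degeneracy (p6's argument). Everything PROVED, 0 sorry; NO definition is
introduced (the generating set is written out).
References: [BourbakiAlgebre1a3] Ch. II §7 no. 5 (dual bases), Ch. III §7 no. 1, §11 no. 9 (interior products);
[BuchweitzFlenner2008HH] Prop. 6.4.4 (why these operators).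
-/

noncomputable section

open CliffordAlgebra (contractLeft)
open ExteriorAlgebra (ι)
open Module

namespace Summit.Ventures.HSemireg.WeilFrame

open Summit.Ventures.HSemireg.WedgeBridge Summit.Ventures.HSemireg.ContractionSpan

variable {K : Type*} [Field K] {V : Type*} [AddCommGroup V] [Module K V]

/-! ### 1. The generating set of a Weil datum and the collecting lemma -/

/-! The WEIL GENERATING SET of a datum `(L; P, Q)` is written out everywhere below (no definition is introduced):
`{z | ∃ x l, ((x ∈ P ∧ l ∈ L ⊓ Q) ∨ (x ∈ Q ∧ l ∈ L ⊓ P)) ∧ z = ι x * ι l}` — the 2-vectors `x ∧ l` of «Hodge type `(1,1)` and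
`k`-bidegree `(1,1)`». -/

/-- a generator `x ∧ l` with `x ∈ P`, `l ∈ L ⊓ Q` lies in the Weil generating set. -/
lemma ι_mul_ι_mem_weilGen_left {L P Q : Submodule K V} {x l : V} (hx : x ∈ P) (hl : l ∈ L ⊓ Q) :
    ι K x * ι K l ∈ {z : ExteriorAlgebra K V | ∃ x l : V, ((x ∈ P ∧ l ∈ L ⊓ Q) ∨ (x ∈ Q ∧ l ∈ L ⊓ P)) ∧ z = ι K x * ι K l} :=
  ⟨x, l, Or.inl ⟨hx, hl⟩, rfl⟩

/-- a generator `x ∧ l` with `x ∈ Q`, `l ∈ L ⊓ P` lies in the Weil generating set. -/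
lemma ι_mul_ι_mem_weilGen_right {L P Q : Submodule K V} {x l : V} (hx : x ∈ Q) (hl : l ∈ L ⊓ P) :
    ι K x * ι K l ∈ {z : ExteriorAlgebra K V | ∃ x l : V, ((x ∈ P ∧ l ∈ L ⊓ Q) ∨ (x ∈ Q ∧ l ∈ L ⊓ P)) ∧ z = ι K x * ι K l} :=
  ⟨x, l, Or.inr ⟨hx, hl⟩, rfl⟩

/-- expanding a member of a subspace on a basis of that subspace, inside `V`. -/
lemma coe_eq_sum_repr {S : Submodule K V} {n : ℕ} (b : Basis (Fin n) K S) (l : S) :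
    (l : V) = ∑ i, b.repr l i • (b i : V) := by
  have h := congrArg (Submodule.subtype S) (b.sum_repr l).symm
  rw [map_sum] at h
  simpa only [Submodule.subtype_apply, map_smul] using h

/-- **Collecting a Weil 2-vector on bases of `L ⊓ Q` and `L ⊓ P`:** `c` in the span of the Weil generating set is
`Σ_i v₁ i ∧ bQ i + Σ_j v₂ j ∧ bP j` with `v₁ i ∈ P`, `v₂ j ∈ Q`. [cite: BourbakiAlgebre1a3, Ch. III §7 no. 1] -/
theorem exists_eq_sum_of_mem_span_weilGen {p r : ℕ} {L P Q : Submodule K V}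
    (bQ : Basis (Fin p) K ↥(L ⊓ Q)) (bP : Basis (Fin r) K ↥(L ⊓ P)) {c : ExteriorAlgebra K V}
    (hc : c ∈ Submodule.span K {z : ExteriorAlgebra K V | ∃ x l : V, ((x ∈ P ∧ l ∈ L ⊓ Q) ∨ (x ∈ Q ∧ l ∈ L ⊓ P)) ∧ z = ι K x * ι K l}) :
    ∃ (v₁ : Fin p → ↥P) (v₂ : Fin r → ↥Q),
      c = ∑ i, ι K (v₁ i : V) * ι K (bQ i : V) + ∑ j, ι K (v₂ j : V) * ι K (bP j : V) := by
  induction hc using Submodule.span_induction with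
  | mem z hz =>
    obtain ⟨x, l, hxl, rfl⟩ := hz
    rcases hxl with ⟨hx, hl⟩ | ⟨hx, hl⟩
    · refine ⟨fun i => bQ.repr ⟨l, hl⟩ i • ⟨x, hx⟩, 0, ?_⟩
      simp only [Pi.zero_apply, ZeroMemClass.coe_zero, map_zero, zero_mul, Finset.sum_const_zero, add_zero]
      have hl' : l = ∑ i, bQ.repr ⟨l, hl⟩ i • (bQ i : V) := coe_eq_sum_repr bQ ⟨l, hl⟩
      conv_lhs => rw [hl', map_sum, Finset.mul_sum]
      refine Finset.sum_congr rfl fun i _ => ?_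
      rw [Submodule.coe_smul, map_smul, map_smul, mul_smul_comm, smul_mul_assoc]
    · refine ⟨0, fun j => bP.repr ⟨l, hl⟩ j • ⟨x, hx⟩, ?_⟩
      simp only [Pi.zero_apply, ZeroMemClass.coe_zero, map_zero, zero_mul, Finset.sum_const_zero, zero_add]
      have hl' : l = ∑ j, bP.repr ⟨l, hl⟩ j • (bP j : V) := coe_eq_sum_repr bP ⟨l, hl⟩
      conv_lhs => rw [hl', map_sum, Finset.mul_sum]
      refine Finset.sum_congr rfl fun j _ => ?_
      rw [Submodule.coe_smul, map_smul, map_smul, mul_smul_comm, smul_mul_assoc]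
  | zero =>
    exact ⟨0, 0, by simp only [Pi.zero_apply, ZeroMemClass.coe_zero, map_zero, zero_mul, Finset.sum_const_zero, add_zero]⟩
  | add x y _ _ hx hy =>
    obtain ⟨v₁, v₂, rfl⟩ := hx
    obtain ⟨v₁', v₂', rfl⟩ := hy
    refine ⟨v₁ + v₁', v₂ + v₂', ?_⟩
    rw [add_add_add_comm, ← Finset.sum_add_distrib, ← Finset.sum_add_distrib]
    congr 1
    · exact Finset.sum_congr rfl fun i _ => by rw [Pi.add_apply, Submodule.coe_add, map_add, add_mul]
    · exact Finset.sum_congr rfl fun j _ => by rw [Pi.add_apply, Submodule.coe_add, map_add, add_mul]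
  | smul t x _ hx =>
    obtain ⟨v₁, v₂, rfl⟩ := hx
    refine ⟨t • v₁, t • v₂, ?_⟩
    rw [smul_add, Finset.smul_sum, Finset.smul_sum]
    congr 1
    · exact Finset.sum_congr rfl fun i _ => by rw [Pi.smul_apply, Submodule.coe_smul, map_smul, smul_mul_assoc]
    · exact Finset.sum_congr rfl fun j _ => by rw [Pi.smul_apply, Submodule.coe_smul, map_smul, smul_mul_assoc]

/-! ### 2. Adapted Weil frames exist -/

/-- `ℓ ∧ (-v) = v ∧ ℓ` in the exterior algebra. [cite: BourbakiAlgebre1a3, Ch. III §7 no. 1] -/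
lemma ι_mul_ι_neg (ℓ' v : V) : ι K ℓ' * ι K (-v) = ι K v * ι K ℓ' := by
  rw [map_neg, mul_neg, neg_eq_iff_add_eq_zero, ExteriorAlgebra.ι_add_mul_swap]

/-- **ADAPTED WEIL FRAMES EXIST.** A Weil datum — `dim V = 2(p + r)`, `dim L = p + r`, disjoint blocks `P`, `Q` with
`dim (L ⊓ Q) = p`, `dim (L ⊓ P) = r`, a 2-vector `Θ` in the span of the Weil generating set, non-degenerate on `L^⊥` — admits an adapted
basis `bV` (`Fin ((p + r) + (p + r))`): `Lsp bV = L`; `ℓ_a ∈ Q`, `m_a ∈ P` for `a < p`; `ℓ_a ∈ P`, `m_a ∈ Q` for `a ≥ p`;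
`Θ = Σ_a ℓ_a ∧ m_a`. [cite: BourbakiAlgebre1a3, Ch. II §7 no. 5] [cite: BourbakiAlgebre1a3, Ch. III §11 no. 9] -/
theorem exists_adapted_basis [FiniteDimensional K V] {p r : ℕ} (hV : finrank K V = (p + r) + (p + r))
    (L P Q : Submodule K V) (hPQ : Disjoint P Q) (hL : finrank K L = p + r)
    (hLQ : finrank K ↥(L ⊓ Q) = p) (hLP : finrank K ↥(L ⊓ P) = r) {Θ : ExteriorAlgebra K V}
    (hΘ : Θ ∈ Submodule.span K {z : ExteriorAlgebra K V | ∃ x l : V, ((x ∈ P ∧ l ∈ L ⊓ Q) ∨ (x ∈ Q ∧ l ∈ L ⊓ P)) ∧ z = ι K x * ι K l})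
    (hnd : ∀ l ∈ (L : Set V), ι K l ∈ Submodule.span K {y : ExteriorAlgebra K V |
      ∃ φ ∈ {θ : Module.Dual K V | ∀ q ∈ L, θ q = 0}, y = contractLeft φ Θ}) :
    ∃ bV : Basis (Fin ((p + r) + (p + r))) K V,
      Lsp bV = L ∧
      (∀ a : Fin (p + r), (a : ℕ) < p → ℓ bV a ∈ Q ∧ m bV a ∈ P) ∧
      (∀ a : Fin (p + r), p ≤ (a : ℕ) → ℓ bV a ∈ P ∧ m bV a ∈ Q) ∧
      Θ = ∑ a : Fin (p + r), ι K (ℓ bV a) * ι K (m bV a) := by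
  let bQ : Basis (Fin p) K ↥(L ⊓ Q) := (Module.finBasis K ↥(L ⊓ Q)).reindex (finCongr hLQ)
  let bP : Basis (Fin r) K ↥(L ⊓ P) := (Module.finBasis K ↥(L ⊓ P)).reindex (finCongr hLP)
  obtain ⟨v₁, v₂, hΘ'⟩ := exists_eq_sum_of_mem_span_weilGen bQ bP hΘ
  -- the `ℓ`-half: bases of `L ⊓ Q` then `L ⊓ P`; the partners `v`; the `m`-half is `-v`
  let ℓf : Fin (p + r) → V := Fin.append (fun i => (bQ i : V)) (fun j => (bP j : V))
  let vf : Fin (p + r) → V := Fin.append (fun i => (v₁ i : V)) (fun j => (v₂ j : V))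
  have hℓL : ∀ a, ℓf a ∈ L := by
    intro a
    by_cases h : (a : ℕ) < p
    · rw [show a = Fin.castAdd r ⟨a, h⟩ from Fin.ext rfl]; simp only [ℓf, Fin.append_left]; exact (bQ _).2.1
    · rw [show a = Fin.natAdd p ⟨a - p, by omega⟩ from Fin.ext (by simp only [Fin.natAdd_mk]; omega)]; simp only [ℓf, Fin.append_right]
      exact (bP _).2.1
  have hΘv : Θ = ∑ a, ι K (vf a) * ι K (ℓf a) := by
    rw [hΘ', Fin.sum_univ_add]
    simp only [ℓf, vf, Fin.append_left, Fin.append_right]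
  -- independence of the `ℓ`-half (disjointness of the blocks)
  have hliQ : LinearIndependent K (fun i => (bQ i : V)) :=
    bQ.linearIndependent.map' (L ⊓ Q).subtype (Submodule.ker_subtype _)
  have hliP : LinearIndependent K (fun j => (bP j : V)) :=
    bP.linearIndependent.map' (L ⊓ P).subtype (Submodule.ker_subtype _)
  have hliℓ : LinearIndependent K ℓf := by
    rw [Fintype.linearIndependent_iff]
    intro g hg
    rw [Fin.sum_univ_add] at hg
    simp only [ℓf, Fin.append_left, Fin.append_right] at hg
    have hxQ : ∑ i, g (Fin.castAdd r i) • (bQ i : V) ∈ Q :=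
      Submodule.sum_mem _ fun i _ => Submodule.smul_mem _ _ (bQ i).2.2
    have hyP : ∑ j, g (Fin.natAdd p j) • (bP j : V) ∈ P :=
      Submodule.sum_mem _ fun j _ => Submodule.smul_mem _ _ (bP j).2.2
    have hy0 : ∑ j, g (Fin.natAdd p j) • (bP j : V) = 0 := by
      refine (Submodule.disjoint_def.mp hPQ) _ hyP ?_
      have : ∑ j, g (Fin.natAdd p j) • (bP j : V) = -∑ i, g (Fin.castAdd r i) • (bQ i : V) :=
        eq_neg_of_add_eq_zero_right hg
      rw [this]; exact Q.neg_mem hxQ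
    have hx0 : ∑ i, g (Fin.castAdd r i) • (bQ i : V) = 0 := by rwa [hy0, add_zero] at hg
    have hgQ := Fintype.linearIndependent_iff.mp hliQ _ hx0
    have hgP := Fintype.linearIndependent_iff.mp hliP _ hy0
    intro a
    by_cases h : (a : ℕ) < p
    · rw [show a = Fin.castAdd r ⟨a, h⟩ from Fin.ext rfl]; exact hgQ _
    · rw [show a = Fin.natAdd p ⟨a - p, by omega⟩ from Fin.ext (by simp only [Fin.natAdd_mk]; omega)]; exact hgP _
  have hliιℓ : LinearIndependent K (fun a => ι K (ℓf a)) :=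
    hliℓ.map' (ι K) (LinearMap.ker_eq_bot.mpr (ExteriorAlgebra.ι_leftInverse (R := K) (M := V)).injective)
  -- the dual system θ_b ∈ L^⊥, θ_b(v_a) = δ_ab (non-degeneracy)
  have hdual : ∀ b, ∃ θ' : Module.Dual K V, (∀ q ∈ L, θ' q = 0) ∧ ∀ a, θ' (vf a) = if a = b then 1 else 0 := by
    intro b
    obtain ⟨φ, hφL, hφc⟩ := exists_contractLeft_eq_of_mem_span L Θ (hnd (ℓf b) (hℓL b))
    refine ⟨φ, hφL, fun a => sub_eq_zero.mp (Fintype.linearIndependent_iff.mp hliιℓ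
      (fun a => φ (vf a) - if a = b then 1 else 0) ?_ a)⟩
    rw [hΘv, map_sum] at hφc
    simp_rw [contractLeft_ι_mul_ι_of_apply_eq_zero _ (hφL _ (hℓL _))] at hφc
    simp_rw [sub_smul, Finset.sum_sub_distrib, hφc, ite_smul, one_smul, zero_smul, Finset.sum_ite_eq',
      Finset.mem_univ, if_true, sub_self]
  choose θ' hθ'L hθ'v using hdual
  -- independence of the full frame (ℓ, -v)
  have hli : LinearIndependent K (Fin.append ℓf (fun a => -vf a)) := by
    rw [Fintype.linearIndependent_iff]
    intro g hg
    rw [Fin.sum_univ_add] at hg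
    simp only [Fin.append_left, Fin.append_right] at hg
    have hβ : ∀ b, g (Fin.natAdd (p + r) b) = 0 := by
      intro b
      have h := congrArg (θ' b) hg
      rw [map_add, map_sum, map_sum, map_zero] at h
      simp_rw [map_smul, map_neg, hθ'v b, hθ'L b _ (hℓL _), smul_eq_mul, mul_zero, Finset.sum_const_zero, zero_add,
        mul_neg, mul_ite, mul_one, mul_zero, Finset.sum_neg_distrib, Finset.sum_ite_eq', Finset.mem_univ, if_true,
        neg_eq_zero] at h
      exact h
    have hα : ∀ a, g (Fin.castAdd (p + r) a) = 0 := by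
      simp_rw [hβ, zero_smul, Finset.sum_const_zero, add_zero] at hg
      exact Fintype.linearIndependent_iff.mp hliℓ _ hg
    intro c
    by_cases h : (c : ℕ) < p + r
    · rw [show c = Fin.castAdd (p + r) ⟨c, h⟩ from Fin.ext rfl]; exact hα _
    · rw [show c = Fin.natAdd (p + r) ⟨c - (p + r), by omega⟩ from Fin.ext (by simp only [Fin.natAdd_mk]; omega)]; exact hβ _
  have hcard : Fintype.card (Fin ((p + r) + (p + r))) = finrank K V := by rw [Fintype.card_fin, hV]
  let bV : Basis (Fin ((p + r) + (p + r))) K V := basisOfLinearIndependentOfCardEqFinrank' _ hli hcard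
  have hbV : ⇑bV = Fin.append ℓf (fun a => -vf a) := coe_basisOfLinearIndependentOfCardEqFinrank' _ _ _
  have hℓ : ∀ a, ℓ bV a = ℓf a := fun a => by rw [ℓ, hbV, Fin.append_left]
  have hm : ∀ a, m bV a = -vf a := fun a => by rw [m, hbV, Fin.append_right]
  refine ⟨bV, ?_, ?_, ?_, ?_⟩
  · -- `Lsp bV = L`
    unfold Lsp
    refine Submodule.eq_of_le_of_finrank_eq (Submodule.span_le.mpr ?_) ?_
    · rintro _ ⟨a, rfl⟩; rw [hℓ]; exact hℓL a
    · rw [show ℓ bV = ℓf from funext hℓ, finrank_span_eq_card hliℓ, Fintype.card_fin, hL]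
  · intro a ha
    rw [hℓ, hm, show a = Fin.castAdd r ⟨a, ha⟩ from Fin.ext rfl]
    simp only [ℓf, vf, Fin.append_left]
    exact ⟨(bQ _).2.2, P.neg_mem (v₁ _).2⟩
  · intro a ha
    rw [hℓ, hm, show a = Fin.natAdd p ⟨a - p, by omega⟩ from Fin.ext (by simp only [Fin.natAdd_mk]; omega)]
    simp only [ℓf, vf, Fin.append_right]
    exact ⟨(bP _).2.2, Q.neg_mem (v₂ _).2⟩
  · rw [hΘv]
    exact Finset.sum_congr rfl fun a _ => by rw [hℓ, hm, ι_mul_ι_neg]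

/-- the same conclusion with `Θ` written through the carrier's `LM bV k = ℓ_k ∧ m_k`: `Θ = Σ_{k < p + r} LM bV k`
(the degree-one layer of `Ecl`, `WedgeCarrierEcl.lean`). [cite: BourbakiAlgebre1a3, Ch. III §7 no. 1] -/
theorem sum_ι_mul_ι_eq_sum_LM {N : ℕ} (bV : Basis (Fin (N + N)) K V) :
    ∑ a : Fin N, ι K (ℓ bV a) * ι K (m bV a) = ∑ k ∈ Finset.range N, LM bV k := by
  rw [Finset.sum_range]
  refine Finset.sum_congr rfl fun a _ => ?_
  rw [LM, ℓN, mN, dif_pos a.2, dif_pos a.2]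

/-! ### 3. The converse: the blocks of any basis form a Weil datum (the hypotheses are exactly right) -/

/-- for ANY basis `bV` of `V` indexed by `Fin ((p + r) + (p + r))`, the 2-vector `Σ_a ℓ_a ∧ m_a` lies in
the span of the Weil generating set of `(Lsp bV; P, Q)` for the two blocks `P ⊇ {ℓ_a (a ≥ p), m_a (a < p)}`, `Q ⊇ {ℓ_a (a < p), m_a (a ≥ p)}`.
[cite: BourbakiAlgebre1a3, Ch. III §7 no. 1] -/
theorem sum_ι_mul_ι_mem_span_weilGen {p r : ℕ} (bV : Basis (Fin ((p + r) + (p + r))) K V) (P Q : Submodule K V)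
    (hℓQ : ∀ a : Fin (p + r), (a : ℕ) < p → ℓ bV a ∈ Q) (hmP : ∀ a : Fin (p + r), (a : ℕ) < p → m bV a ∈ P)
    (hℓP : ∀ a : Fin (p + r), p ≤ (a : ℕ) → ℓ bV a ∈ P) (hmQ : ∀ a : Fin (p + r), p ≤ (a : ℕ) → m bV a ∈ Q) :
    ∑ a : Fin (p + r), ι K (ℓ bV a) * ι K (m bV a) ∈ Submodule.span K
      {z : ExteriorAlgebra K V | ∃ x l : V, ((x ∈ P ∧ l ∈ Lsp bV ⊓ Q) ∨ (x ∈ Q ∧ l ∈ Lsp bV ⊓ P)) ∧ z = ι K x * ι K l} := by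
  refine Submodule.sum_mem _ fun a _ => ?_
  have hswap : ι K (ℓ bV a) * ι K (m bV a) = -(ι K (m bV a) * ι K (ℓ bV a)) := by
    rw [eq_neg_iff_add_eq_zero, ExteriorAlgebra.ι_add_mul_swap]
  rw [hswap]
  refine Submodule.neg_mem _ (Submodule.subset_span ?_)
  by_cases h : (a : ℕ) < p
  · exact ι_mul_ι_mem_weilGen_left (hmP a h) ⟨ℓ_mem bV a, hℓQ a h⟩
  · exact ι_mul_ι_mem_weilGen_right (hmQ a (by omega)) ⟨ℓ_mem bV a, hℓP a (by omega)⟩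

/-- for ANY basis `bV` (indexed by `Fin (N + N)`), `Θ = Σ_a ℓ_a ∧ m_a` is non-degenerate on `L^⊥`, `L = Lsp bV`:
`ι(ℓ_b) = ι_{-θ_b} Θ` with `θ_b` the coordinate form of `m_b` (which kills `L`). [cite: BourbakiAlgebre1a3, Ch. III §11 no. 9] -/
theorem ι_mem_span_contractLeft_sum {N : ℕ} (bV : Basis (Fin (N + N)) K V) {l : V} (hl : l ∈ (Lsp bV : Set V)) :
    ι K l ∈ Submodule.span K {y : ExteriorAlgebra K V | ∃ φ ∈ {θ' : Module.Dual K V | ∀ q ∈ Lsp bV, θ' q = 0},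
      y = contractLeft φ (∑ a : Fin N, ι K (ℓ bV a) * ι K (m bV a))} := by
  have hgen : ∀ b : Fin N, ι K (ℓ bV b) ∈ Submodule.span K {y : ExteriorAlgebra K V |
      ∃ φ ∈ {θ' : Module.Dual K V | ∀ q ∈ Lsp bV, θ' q = 0}, y = contractLeft φ (∑ a : Fin N, ι K (ℓ bV a) * ι K (m bV a))} := by
    intro b
    refine Submodule.subset_span ⟨-θ bV b, fun q hq => ?_, ?_⟩
    · rw [LinearMap.neg_apply, neg_eq_zero]
      exact (Submodule.mem_dualAnnihilator (θ bV b)).mp (θ_mem bV b) q hq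
    · rw [map_sum]
      have hterm : ∀ a : Fin N, contractLeft (-θ bV b) (ι K (ℓ bV a) * ι K (m bV a)) =
          if a = b then ι K (ℓ bV b) else 0 := by
        intro a
        rw [CliffordAlgebra.contractLeft_ι_mul, CliffordAlgebra.contractLeft_ι, LinearMap.neg_apply,
          LinearMap.neg_apply, θ_ℓ, neg_zero, zero_smul, zero_sub, θ_m, map_neg, mul_neg, neg_neg]
        by_cases hab : a = b
        · subst hab; rw [if_pos rfl, if_pos rfl, map_one, mul_one]
        · rw [if_neg (Ne.symm hab), if_neg hab, map_zero, mul_zero]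
      simp_rw [hterm, Finset.sum_ite_eq', Finset.mem_univ, if_true]
  have hl' : l ∈ Submodule.span K (Set.range (ℓ bV)) := by
    have : (Lsp bV : Set V) = (Submodule.span K (Set.range (ℓ bV)) : Set V) := by unfold Lsp; rfl
    rw [← SetLike.mem_coe, ← this]; exact hl
  clear hl
  induction hl' using Submodule.span_induction with
  | mem z hz => obtain ⟨b, rfl⟩ := hz; exact hgen b
  | zero => rw [map_zero]; exact Submodule.zero_mem _
  | add x y _ _ hx hy => rw [map_add]; exact Submodule.add_mem _ hx hy
  | smul t x _ hx => rw [map_smul]; exact Submodule.smul_mem _ t hx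

end Summit.Ventures.HSemireg.WeilFrame

end
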